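import Summits.BirchSwinnertonDyer.BirchSwinnertonDyer.Theorems.AdditiveBranchIMCMultLowerCompanion
import HarnessLib

/-!
# Crux `MultLower` (item 19359), cell (M): the SELMER-COMPANION / VISIBILITY DOORS — `ord_p #Ш(E)_an ≤ ord_p #Ш(E)`
# (every odd `p`, any `W` with `E[p]` irreducible) and `BSD(E,p)` (X4(M) ∩ surj(p), ANY odd `p`) from a
# `p`-congruent partner potentially multiplicative at `p` and ONE named rational point, the additive place
# `p` FREE by kind (iii′) (Mazur–Rubin 2015 Thm. 3.1 (iv)(a) / §6 Case 4 = Silverman ATAEC V.5.3/5.4)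

Cell `bsd-addord`, seat `bsd-addord-k1-c4` (D-0074 row B3), gen 5; sibling of
`AdditiveBranchIMCMultLowerCompanion.lean` (the local dispatch and the visible element of `Ш[p]`, same gen),
which see for the mathematics and the honest framing. HONEST FRAMING: nothing here proves the
Birch–Swinnerton-Dyer conjecture or the crux; THEOREMS ONLY (no definition, no named fact, no `sorry`);
every published input is an explicit named-fact binder; every per-pair input is a displayed binder decided
OUTSIDE this file; nothing is booked by this file. NO Theses import (theses-cone lint): per-pair records
import this module.

## What

* `missingLowerBoundAt_rankZero_irr_of_potMultWitness[₆]` — `MissingLowerBoundAt W p` for ANY `W/ℚ` with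
  `E[p]` irreducible, `r_an = 0`, `ord_p #Ш_an ≤ 2`, EVERY odd `p`, from Cassels–Tate (`hCT`), GZK (`hGZK`),
  Tate uniformisation A41 (`hU2`) [+ `hU`, Fisher 2016 Thm. 4.4 `hF44` for kinds (ii)/(iv)] and the per-pair
  data (partner `W'`, `θ : W'[p] ⥲ W[p]`, places `S`, witness `P ∈ W'(ℚ) ∖ pW'(ℚ)` with local options
  (a)/(i)/(iii′) [/(ii)/(iii)/(iv)]). NO reduction hypothesis on `W` at `p`.
* `missingLowerBoundAt_rankZero_cellM_irr_of_companionWitness` — the cell-(M) form: `N10.CellM W p` supplies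
  `p ≠ 2` and `ord_p j(W) < 0`; at the place `p` the per-pair data reduce to `ord_p j(W') < 0` + the square
  class `γ(W) = r² γ(W')` in `ℚ_p` (`μ_p(ℚ_p) = 1` automatic).
* `bsdp_rankZero_cellM_surj_of_companionWitness[₆]` — `BSDp W p` on X4(M) ∩ surj(p) ∩ `r_an = 0`, ANY odd
  `p`: + team n1011's upper half `ClassX4M.bsdp_rankZero_of_surj_of_lower_noL20` (`hDel hKato hmod hmodD`)
  — the BOOKING door (an OFFER shape for referee A once a per-pair record instantiates it).

NO engine value, NO λ / budget / rank binder, NO Kato–EPW–GV–Delbourgo on the lower side. Reach: the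
216 «Door3((M) partner)» rows of k1-c2 gen 3's census j253895 (X4(M) ∩ surj ∩ `r_an = 0` ∩ `ord_p #Ш_an = 2`,
`p ≥ 5`, clean rank-2 partner of the same kind) are the clientele; the per-place census is this gen's kit job.

References: Mazur–Rubin 2015 Thm. 3.1 (iv)(a), §6 Case 4 [MazurRubin2015SelmerCompanions]; Silverman ATAEC
V.5.2–5.4 [SilvermanATAEC1994]; Cremona–Mazur 2000 §3 [CremonaMazur2000]; Agashe–Stein 2002 Lemma 3.6
[AgasheStein2002]; Fisher 2016 Thm. 4.4 [Fisher2016Visualizing7]; Silverman AEC X.4.14 [SilvermanAEC2009];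
Kato 2004 Thm. 17.4 (3) [Kato2004Asterisque]; Delbourgo 1998 Prop. 4 [Delbourgo1998]; Wuthrich 2014 Thm. 3 /
Cor. 19 [Wuthrich2014]; Miller 2011 Def. 1.1 [Miller2011LMS]; Cassels 1986 Ch. 6 [Cassels1986].
-/

set_option autoImplicit false

noncomputable section

open scoped Classical

open WeierstrassCurve Literature.NumberTheory.EllipticCurves
  Literature.NumberTheory.EllipticCurves.Rank1Residual
  Literature.NumberTheory.EllipticCurves.Rank1Residual.Typed
  Literature.NumberTheory.EllipticCurves.Wuthrich2014
  Literature.NumberTheory.EllipticCurves.Fisher2016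
  Literature.NumberTheory.GaloisRepresentations
  Summit.BirchSwinnertonDyer.Rank1Residual.GaloisImage
  Summit.BirchSwinnertonDyer.Rank1Residual.X11b.CongruentTransfer
open NumberField IsDedekindDomain Rat.HeightOneSpectrum Field
  Literature.NumberTheory.EllipticCurves.ModularForms

set_option linter.dupNamespace false

namespace Summit.BirchSwinnertonDyer.BirchSwinnertonDyer.Theorems.AdditiveBranchIMCMultLowerCompanion

open Summit.BirchSwinnertonDyer.Rank1Residual
open Summit.BirchSwinnertonDyer.Rank1Residual.Additive
open Summit.BirchSwinnertonDyer.Rank1Residual.AdditivePotMult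


/-! ## §3 The DOORS: the lower half for any `W` with `E[p]` irreducible; the cell-(M) forms; `BSD(E,p)` on X4(M) -/

section Doors

variable {W : WeierstrassCurve ℚ} [W.IsElliptic] [W.IsGloballyMinimal] {p : ℕ} [hp : Fact p.Prime]

omit [W.IsGloballyMinimal] in
/-- **The LOWER half by visibility with the potentially-multiplicative kind, {`E[p]` irreducible} ∩
`r_an = 0`, EVERY odd `p`, lean form.** Published inputs (binders): Cassels–Tate (`hCT`), GZK (`hGZK`),
Tate uniformisation A41 (`hU2`). Per-pair data (binders, decidable outside this file): the partner `W'`, a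
`Γ_ℚ`-isomorphism `θ : W'[p] ⥲ W[p]`, the finite set `S` of places (both curves good and `w ∤ p` outside),
ONE point `P ∈ W'(ℚ) ∖ pW'(ℚ)` and, at each `w ∈ S`: (a) a `p`-th root of `P` in `W'(ℚ_w)`, or (i) `w ∤ p`
with `W'(ℚ_w)[p] = 0`, or (iii′) `|j(W)|_w > 1`, `|j(W')|_w > 1`, same `γ`-class, `μ_p(ℚ_w) = 1` (the
additive place `p` of an (M) pair with an (M)-type partner; also any shared multiplicative place
`w ≢ 1 (mod p)`); and the datum `#Ш(E)_an = q` with `ord_p q ≤ 2`. Chain: §2 (`E(ℚ)` finite by GZK, of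
order prime to `p` by irreducibility) ⟹ `p ∣ #Ш(E)` ⟹ Cassels–Tate squareness
(`missingLowerBoundAt_of_casselsTate_of_pow_dvd`) ⟹ `ord_p #Ш_an ≤ ord_p #Ш`. NO Kato / EPW / GV /
Delbourgo / Pal binder, NO engine value, NO rank binder, NO reduction hypothesis on `W` at `p`. Per pair;
NOT a class theorem; the crux stays OPEN. [cite: MazurRubin2015SelmerCompanions, Thm. 3.1 (iv)(a) and §6 Case 4]
[cite: CremonaMazur2000, §3 and Table 1] [cite: AgasheStein2002, Lemma 3.6] [cite: SilvermanAEC2009, Thm. X.4.14]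
[cite: SilvermanATAEC1994, Ch. V Thm. 5.3, Cor. 5.4] -/
theorem missingLowerBoundAt_rankZero_irr_of_potMultWitness
    (hCT : exists_casselsTate_pairing (K := ℚ)) (hGZK : rank_eq_analyticRank_of_analyticRank_le_one)
    (hU2 : Silverman1994_thmV53_corV54_tateUniformisation.{0})
    (hp2 : p ≠ 2) (hirr : Irr W p) (hr : W.analyticRank = 0)
    {q : ℚ} (hq : shaAn W = (q : ℂ)) (hv : padicValRat p q ≤ 2)
    (W' : WeierstrassCurve ℚ) [W'.IsElliptic]
    (θ : geomTorsion W' (p : ℤ) ≃+ geomTorsion W (p : ℤ))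
    (hθ : ∀ (σ : absoluteGaloisGroup ℚ) (P : geomTorsion W' (p : ℤ)), θ (σ • P) = σ • θ P)
    (S : Finset (HeightOneSpectrum (𝓞 ℚ)))
    (hS : ∀ w : HeightOneSpectrum (𝓞 ℚ), w ∉ S →
      W.HasGoodReductionAt w ∧ W'.HasGoodReductionAt w ∧ (p : 𝓞 ℚ) ∉ w.asIdeal)
    (P : W'.toAffine.Point)
    (hP : P ∉ (zsmulAddGroupHom (p : ℤ) : W'.toAffine.Point →+ W'.toAffine.Point).range)
    (hplaces : ∀ w ∈ S,
      (∃ Q : (W'.baseChange (w.adicCompletion ℚ)).toAffine.Point,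
        p • Q = WeierstrassCurve.Affine.Point.baseChange (W' := W') ℚ (w.adicCompletion ℚ) P) ∨
      ((p : 𝓞 ℚ) ∉ w.asIdeal ∧ Nat.card (nsmulAddMonoidHom p :
          (W'.baseChange (w.adicCompletion ℚ)).toAffine.Point →+ _).ker = 1) ∨
      (1 < w.valuation ℚ W.j ∧ 1 < w.valuation ℚ W'.j ∧
        (∃ r : w.adicCompletion ℚ, algebraMap ℚ (w.adicCompletion ℚ) (-(W.c₄ / W.c₆)) =
          r ^ 2 * algebraMap ℚ (w.adicCompletion ℚ) (-(W'.c₄ / W'.c₆))) ∧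
        (∀ ζ : w.adicCompletion ℚ, ζ ^ p = 1 → ζ = 1))) :
    MissingLowerBoundAt W p := by
  haveI hfin : Finite W.toAffine.Point := finite_point_of_analyticRank_eq_zero W hGZK hr
  have hcop : (Nat.card W.toAffine.Point).Coprime p := coprime_natCard_point_of_irr W p hirr
  have hex : ∃ c : W.sha, c ≠ 0 ∧ p • c = 0 :=
    exists_sha_ne_zero_of_congr_of_witness_potMult hU2 hp2 θ hθ S hS hfin hcop P hP hplaces
  have hfinSha : W.ShaFinite := (hGZK W (by rw [hr]; norm_num)).2
  exact missingLowerBoundAt_of_casselsTate_of_pow_dvd W p hCT hfinSha hq (k := 1) (by simpa using hv)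
    (by simpa using dvd_shaOrder_of_exists_torsion W p hex)

omit [W.IsGloballyMinimal] in
/-- **The LOWER half by visibility with the potentially-multiplicative kind, six-option form** (kinds
(ii)/(iii)/(iv) at the other multiplicative places available: `hU`/`hU2`, Fisher 2016 Thm. 4.4 `hF44`). As
`…_of_potMultWitness` otherwise. [cite: MazurRubin2015SelmerCompanions, Thm. 3.1 (iv)(a) and §6 Case 4]
[cite: Fisher2016Visualizing7, Thm. 4.4 (p. 106)] [cite: SilvermanATAEC1994, Ch. V Thm. 3.1, Thm. 5.3, Cor. 5.4]
[cite: CremonaMazur2000, §3] [cite: SilvermanAEC2009, Thm. X.4.14] -/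
theorem missingLowerBoundAt_rankZero_irr_of_potMultWitness₆
    (hCT : exists_casselsTate_pairing (K := ℚ)) (hGZK : rank_eq_analyticRank_of_analyticRank_le_one)
    (hU : Silverman1994_thmV53_tateUniformisation.{0})
    (hU2 : Silverman1994_thmV53_corV54_tateUniformisation.{0})
    (hF44 : thm44_selmerLocalKer_iff_of_nonsplit_good)
    (hp2 : p ≠ 2) (hirr : Irr W p) (hr : W.analyticRank = 0)
    {q : ℚ} (hq : shaAn W = (q : ℂ)) (hv : padicValRat p q ≤ 2)
    (W' : WeierstrassCurve ℚ) [W'.IsElliptic]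
    (θ : geomTorsion W' (p : ℤ) ≃+ geomTorsion W (p : ℤ))
    (hθ : ∀ (σ : absoluteGaloisGroup ℚ) (P : geomTorsion W' (p : ℤ)), θ (σ • P) = σ • θ P)
    (S : Finset (HeightOneSpectrum (𝓞 ℚ)))
    (hS : ∀ w : HeightOneSpectrum (𝓞 ℚ), w ∉ S →
      W.HasGoodReductionAt w ∧ W'.HasGoodReductionAt w ∧ (p : 𝓞 ℚ) ∉ w.asIdeal)
    (P : W'.toAffine.Point)
    (hP : P ∉ (zsmulAddGroupHom (p : ℤ) : W'.toAffine.Point →+ W'.toAffine.Point).range)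
    (hplaces : ∀ w ∈ S,
      (∃ Q : (W'.baseChange (w.adicCompletion ℚ)).toAffine.Point,
        p • Q = WeierstrassCurve.Affine.Point.baseChange (W' := W') ℚ (w.adicCompletion ℚ) P) ∨
      ((p : 𝓞 ℚ) ∉ w.asIdeal ∧ Nat.card (nsmulAddMonoidHom p :
          (W'.baseChange (w.adicCompletion ℚ)).toAffine.Point →+ _).ker = 1) ∨
      (W.HasSplitMultiplicativeReductionAt w ∧ W'.HasSplitMultiplicativeReductionAt w ∧
        Nat.card (nsmulAddMonoidHom p :
          (W.baseChange (w.adicCompletion ℚ)).toAffine.Point →+ _).ker ≤ p) ∨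
      (W.HasMultiplicativeReductionAt w ∧ W'.HasMultiplicativeReductionAt w ∧
        (∃ r : w.adicCompletion ℚ, algebraMap ℚ (w.adicCompletion ℚ) (-(W.c₄ / W.c₆)) =
          r ^ 2 * algebraMap ℚ (w.adicCompletion ℚ) (-(W'.c₄ / W'.c₆))) ∧
        (∀ ζ : w.adicCompletion ℚ, ζ ^ p = 1 → ζ = 1)) ∨
      ((W.HasMultiplicativeReductionAt w ∧ ¬ W.HasSplitMultiplicativeReductionAt w ∧
          W'.HasGoodReductionAt w) ∨
        (W.HasGoodReductionAt w ∧ W'.HasMultiplicativeReductionAt w ∧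
          ¬ W'.HasSplitMultiplicativeReductionAt w)) ∨
      (1 < w.valuation ℚ W.j ∧ 1 < w.valuation ℚ W'.j ∧
        (∃ r : w.adicCompletion ℚ, algebraMap ℚ (w.adicCompletion ℚ) (-(W.c₄ / W.c₆)) =
          r ^ 2 * algebraMap ℚ (w.adicCompletion ℚ) (-(W'.c₄ / W'.c₆))) ∧
        (∀ ζ : w.adicCompletion ℚ, ζ ^ p = 1 → ζ = 1))) :
    MissingLowerBoundAt W p := by
  haveI hfin : Finite W.toAffine.Point := finite_point_of_analyticRank_eq_zero W hGZK hr
  have hcop : (Nat.card W.toAffine.Point).Coprime p := coprime_natCard_point_of_irr W p hirr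
  have hex : ∃ c : W.sha, c ≠ 0 ∧ p • c = 0 :=
    exists_sha_ne_zero_of_congr_of_witness_potMult₆ hU hU2 hF44 hp2 θ hθ S hS hfin hcop P hP hplaces
  have hfinSha : W.ShaFinite := (hGZK W (by rw [hr]; norm_num)).2
  exact missingLowerBoundAt_of_casselsTate_of_pow_dvd W p hCT hfinSha hq (k := 1) (by simpa using hv)
    (by simpa using dvd_shaOrder_of_exists_torsion W p hex)

omit [W.IsGloballyMinimal] in
/-- **The LOWER half on cell (M) ∩ {`E[p]` irreducible} ∩ `r_an = 0` with an (M)-TYPE partner, every odd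
`p`** (the COMPANION form the census instantiates): the cell `N10.CellM W p` supplies `p ≠ 2` and
`ord_p j(W) < 0`; the per-pair data at the place `p` reduce to `ord_p j(W') < 0` (the partner is
potentially multiplicative at `p` too — Mazur–Rubin's `𝔭 ∈ S₁ = S₂`) and the square class
`γ(W) = r² γ(W')` in `ℚ_p`; `μ_p(ℚ_p) = 1` is automatic (§0). Elsewhere on `S`: (a) / (i) / (iii′) as in
`…_of_potMultWitness`. [cite: MazurRubin2015SelmerCompanions, Thm. 3.1 (iv)(a) and §6 Case 4]
[cite: CremonaMazur2000, §3 and Table 1] [cite: SilvermanAEC2009, Thm. X.4.14]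
[cite: SilvermanATAEC1994, Ch. V Thm. 5.3, Cor. 5.4] -/
theorem missingLowerBoundAt_rankZero_cellM_irr_of_companionWitness
    (hCT : exists_casselsTate_pairing (K := ℚ)) (hGZK : rank_eq_analyticRank_of_analyticRank_le_one)
    (hU2 : Silverman1994_thmV53_corV54_tateUniformisation.{0})
    (hc : N10.CellM W p) (hirr : Irr W p) (hr : W.analyticRank = 0)
    {q : ℚ} (hq : shaAn W = (q : ℂ)) (hv : padicValRat p q ≤ 2)
    (W' : WeierstrassCurve ℚ) [W'.IsElliptic] (hj' : padicValRat p W'.j < 0)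
    (hγ : ∀ v : HeightOneSpectrum (𝓞 ℚ), (p : 𝓞 ℚ) ∈ v.asIdeal →
      ∃ r : v.adicCompletion ℚ, algebraMap ℚ (v.adicCompletion ℚ) (-(W.c₄ / W.c₆)) =
        r ^ 2 * algebraMap ℚ (v.adicCompletion ℚ) (-(W'.c₄ / W'.c₆)))
    (θ : geomTorsion W' (p : ℤ) ≃+ geomTorsion W (p : ℤ))
    (hθ : ∀ (σ : absoluteGaloisGroup ℚ) (P : geomTorsion W' (p : ℤ)), θ (σ • P) = σ • θ P)
    (S : Finset (HeightOneSpectrum (𝓞 ℚ)))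
    (hS : ∀ w : HeightOneSpectrum (𝓞 ℚ), w ∉ S →
      W.HasGoodReductionAt w ∧ W'.HasGoodReductionAt w ∧ (p : 𝓞 ℚ) ∉ w.asIdeal)
    (P : W'.toAffine.Point)
    (hP : P ∉ (zsmulAddGroupHom (p : ℤ) : W'.toAffine.Point →+ W'.toAffine.Point).range)
    (hplaces : ∀ w ∈ S,
      (∃ Q : (W'.baseChange (w.adicCompletion ℚ)).toAffine.Point,
        p • Q = WeierstrassCurve.Affine.Point.baseChange (W' := W') ℚ (w.adicCompletion ℚ) P) ∨
      ((p : 𝓞 ℚ) ∉ w.asIdeal ∧ Nat.card (nsmulAddMonoidHom p :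
          (W'.baseChange (w.adicCompletion ℚ)).toAffine.Point →+ _).ker = 1) ∨
      ((p : 𝓞 ℚ) ∈ w.asIdeal) ∨
      (1 < w.valuation ℚ W.j ∧ 1 < w.valuation ℚ W'.j ∧
        (∃ r : w.adicCompletion ℚ, algebraMap ℚ (w.adicCompletion ℚ) (-(W.c₄ / W.c₆)) =
          r ^ 2 * algebraMap ℚ (w.adicCompletion ℚ) (-(W'.c₄ / W'.c₆))) ∧
        (∀ ζ : w.adicCompletion ℚ, ζ ^ p = 1 → ζ = 1))) :
    MissingLowerBoundAt W p := by
  obtain ⟨hp2, -, hj⟩ := hc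
  change padicValRat p W.j < 0 at hj
  refine missingLowerBoundAt_rankZero_irr_of_potMultWitness hCT hGZK hU2 hp2 hirr hr hq hv W' θ hθ S hS
    P hP fun w hw ↦ ?_
  rcases hplaces w hw with h | h | hwp | h
  · exact Or.inl h
  · exact Or.inr (Or.inl h)
  · -- the additive place `p`: both curves potentially multiplicative, same twist class; `μ_p(ℚ_p) = 1`
    have hpv : (primesEquiv w : ℕ) = p := primesEquiv_eq_of_natCast_mem w hp.out hwp
    have hjW0 : W.j ≠ 0 := fun h ↦ by rw [h, padicValRat.zero] at hj; exact lt_irrefl _ hj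
    have hjW'0 : W'.j ≠ 0 := fun h ↦ by rw [h, padicValRat.zero] at hj'; exact lt_irrefl _ hj'
    exact Or.inr (Or.inr ⟨(TwistedKummer.one_lt_valuation_iff_padicValRat_neg w hpv hjW0).mpr hj,
      (TwistedKummer.one_lt_valuation_iff_padicValRat_neg w hpv hjW'0).mpr hj', hγ w hwp,
      adicCompletion_rat_pow_eq_one_imp_eq_one_above hp2 w hpv⟩)
  · exact Or.inr (Or.inr h)

/-- **`BSD(E,p)` by visibility on X4(M) ∩ surj(p) ∩ `r_an = 0`, ANY odd `p` — the BOOKING door.** The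
lower half `missingLowerBoundAt_rankZero_cellM_irr_of_companionWitness` (`E[p]` irreducible ⟸ `ρ̄` onto) +
team n1011's UPPER half `ClassX4M.missingUpperBoundAt_rankZero_of_surj_noL20` packaged as
`ClassX4M.bsdp_rankZero_of_surj_of_lower_noL20` (Delbourgo 1998 Prop. 4 `hDel`, GZK, modularity `hmod`
`hmodD`, Kato's divisibility read on the `ω^{(p−1)/2}`-component `hKato`; NO `ram`, Tamagawa, Manin or
`j`-witness hypothesis). Named facts: `hCT hGZK hU2` (lower) + `hDel hKato hmod hmodD` (upper); per-pair
binders as in the lower door + `Surj W p`. Per pair (an OFFER shape for referee A); NOT a class theorem;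
nothing booked. [cite: MazurRubin2015SelmerCompanions, Thm. 3.1 (iv)(a) and §6 Case 4]
[cite: CremonaMazur2000, §3 and Table 1] [cite: Delbourgo1998, Prop. 4 (p. 144) and Lemma (ii) (p. 139)]
[cite: Kato2004Asterisque, Thm. 17.4 (3) (p. 273)] [cite: Wuthrich2014, Thm. 3 (p. 383), Cor. 19 (p. 398)]
[cite: Miller2011LMS, §1 and Def. 1.1] -/
theorem bsdp_rankZero_cellM_surj_of_companionWitness
    (hCT : exists_casselsTate_pairing (K := ℚ)) (hGZK : rank_eq_analyticRank_of_analyticRank_le_one)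
    (hU2 : Silverman1994_thmV53_corV54_tateUniformisation.{0})
    (hDel : Delbourgo1998.prop4_rankZero_pow_dvd_constantCoeff)
    (hKato : Wuthrich2014.kato_halfEigenCharIdeal_dvd_cyclotomicPrime_of_surjective)
    (hmod : hasEntireLFunction_rat) (hmodD : nonempty_modularParametrizationData)
    (hc : N10.CellM W p) (hsurj : Surj W p) (hr : W.analyticRank = 0)
    {q : ℚ} (hq : shaAn W = (q : ℂ)) (hv : padicValRat p q ≤ 2)
    (W' : WeierstrassCurve ℚ) [W'.IsElliptic] (hj' : padicValRat p W'.j < 0)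
    (hγ : ∀ v : HeightOneSpectrum (𝓞 ℚ), (p : 𝓞 ℚ) ∈ v.asIdeal →
      ∃ r : v.adicCompletion ℚ, algebraMap ℚ (v.adicCompletion ℚ) (-(W.c₄ / W.c₆)) =
        r ^ 2 * algebraMap ℚ (v.adicCompletion ℚ) (-(W'.c₄ / W'.c₆)))
    (θ : geomTorsion W' (p : ℤ) ≃+ geomTorsion W (p : ℤ))
    (hθ : ∀ (σ : absoluteGaloisGroup ℚ) (P : geomTorsion W' (p : ℤ)), θ (σ • P) = σ • θ P)
    (S : Finset (HeightOneSpectrum (𝓞 ℚ)))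
    (hS : ∀ w : HeightOneSpectrum (𝓞 ℚ), w ∉ S →
      W.HasGoodReductionAt w ∧ W'.HasGoodReductionAt w ∧ (p : 𝓞 ℚ) ∉ w.asIdeal)
    (P : W'.toAffine.Point)
    (hP : P ∉ (zsmulAddGroupHom (p : ℤ) : W'.toAffine.Point →+ W'.toAffine.Point).range)
    (hplaces : ∀ w ∈ S,
      (∃ Q : (W'.baseChange (w.adicCompletion ℚ)).toAffine.Point,
        p • Q = WeierstrassCurve.Affine.Point.baseChange (W' := W') ℚ (w.adicCompletion ℚ) P) ∨
      ((p : 𝓞 ℚ) ∉ w.asIdeal ∧ Nat.card (nsmulAddMonoidHom p :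
          (W'.baseChange (w.adicCompletion ℚ)).toAffine.Point →+ _).ker = 1) ∨
      ((p : 𝓞 ℚ) ∈ w.asIdeal) ∨
      (1 < w.valuation ℚ W.j ∧ 1 < w.valuation ℚ W'.j ∧
        (∃ r : w.adicCompletion ℚ, algebraMap ℚ (w.adicCompletion ℚ) (-(W.c₄ / W.c₆)) =
          r ^ 2 * algebraMap ℚ (w.adicCompletion ℚ) (-(W'.c₄ / W'.c₆))) ∧
        (∀ ζ : w.adicCompletion ℚ, ζ ^ p = 1 → ζ = 1))) :
    BSDp W p := by
  have hirr : Irr W p := hasIrreducibleModPGaloisRep_of_hasSurjectiveModNGaloisRep W p hsurj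
  have hX : ClassX4M W p := ⟨⟨hc.1, hc.2.1, hirr⟩, ⟨hc.2.1, hc.2.2⟩⟩
  have hlow : MissingLowerBoundAt W p :=
    missingLowerBoundAt_rankZero_cellM_irr_of_companionWitness hCT hGZK hU2 hc hirr hr hq hv W' hj' hγ θ
      hθ S hS P hP hplaces
  exact ClassX4M.bsdp_rankZero_of_surj_of_lower_noL20 hDel hGZK hmod hmodD hKato hX hr hsurj hlow

/-- **`BSD(E,p)` by visibility on X4(M) ∩ surj(p) ∩ `r_an = 0`, ANY odd `p`, six-option form** (the other
multiplicative places of `S` may also be of kinds (ii)/(iii)/(iv): `hU`, `hF44`); the place `p` by the cell +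
`ord_p j(W') < 0` + the square class. As `bsdp_rankZero_cellM_surj_of_companionWitness` otherwise.
[cite: MazurRubin2015SelmerCompanions, Thm. 3.1 (iv)(a) and §6 Case 4] [cite: CremonaMazur2000, §3 and Table 1]
[cite: Fisher2016Visualizing7, Thm. 4.4 (p. 106)] [cite: Delbourgo1998, Prop. 4 (p. 144)]
[cite: Kato2004Asterisque, Thm. 17.4 (3) (p. 273)] [cite: Miller2011LMS, §1 and Def. 1.1] -/
theorem bsdp_rankZero_cellM_surj_of_companionWitness₆
    (hCT : exists_casselsTate_pairing (K := ℚ)) (hGZK : rank_eq_analyticRank_of_analyticRank_le_one)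
    (hU : Silverman1994_thmV53_tateUniformisation.{0})
    (hU2 : Silverman1994_thmV53_corV54_tateUniformisation.{0})
    (hF44 : thm44_selmerLocalKer_iff_of_nonsplit_good)
    (hDel : Delbourgo1998.prop4_rankZero_pow_dvd_constantCoeff)
    (hKato : Wuthrich2014.kato_halfEigenCharIdeal_dvd_cyclotomicPrime_of_surjective)
    (hmod : hasEntireLFunction_rat) (hmodD : nonempty_modularParametrizationData)
    (hc : N10.CellM W p) (hsurj : Surj W p) (hr : W.analyticRank = 0)
    {q : ℚ} (hq : shaAn W = (q : ℂ)) (hv : padicValRat p q ≤ 2)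
    (W' : WeierstrassCurve ℚ) [W'.IsElliptic] (hj' : padicValRat p W'.j < 0)
    (hγ : ∀ v : HeightOneSpectrum (𝓞 ℚ), (p : 𝓞 ℚ) ∈ v.asIdeal →
      ∃ r : v.adicCompletion ℚ, algebraMap ℚ (v.adicCompletion ℚ) (-(W.c₄ / W.c₆)) =
        r ^ 2 * algebraMap ℚ (v.adicCompletion ℚ) (-(W'.c₄ / W'.c₆)))
    (θ : geomTorsion W' (p : ℤ) ≃+ geomTorsion W (p : ℤ))
    (hθ : ∀ (σ : absoluteGaloisGroup ℚ) (P : geomTorsion W' (p : ℤ)), θ (σ • P) = σ • θ P)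
    (S : Finset (HeightOneSpectrum (𝓞 ℚ)))
    (hS : ∀ w : HeightOneSpectrum (𝓞 ℚ), w ∉ S →
      W.HasGoodReductionAt w ∧ W'.HasGoodReductionAt w ∧ (p : 𝓞 ℚ) ∉ w.asIdeal)
    (P : W'.toAffine.Point)
    (hP : P ∉ (zsmulAddGroupHom (p : ℤ) : W'.toAffine.Point →+ W'.toAffine.Point).range)
    (hplaces : ∀ w ∈ S,
      (∃ Q : (W'.baseChange (w.adicCompletion ℚ)).toAffine.Point,
        p • Q = WeierstrassCurve.Affine.Point.baseChange (W' := W') ℚ (w.adicCompletion ℚ) P) ∨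
      ((p : 𝓞 ℚ) ∉ w.asIdeal ∧ Nat.card (nsmulAddMonoidHom p :
          (W'.baseChange (w.adicCompletion ℚ)).toAffine.Point →+ _).ker = 1) ∨
      (W.HasSplitMultiplicativeReductionAt w ∧ W'.HasSplitMultiplicativeReductionAt w ∧
        Nat.card (nsmulAddMonoidHom p :
          (W.baseChange (w.adicCompletion ℚ)).toAffine.Point →+ _).ker ≤ p) ∨
      (W.HasMultiplicativeReductionAt w ∧ W'.HasMultiplicativeReductionAt w ∧
        (∃ r : w.adicCompletion ℚ, algebraMap ℚ (w.adicCompletion ℚ) (-(W.c₄ / W.c₆)) =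
          r ^ 2 * algebraMap ℚ (w.adicCompletion ℚ) (-(W'.c₄ / W'.c₆))) ∧
        (∀ ζ : w.adicCompletion ℚ, ζ ^ p = 1 → ζ = 1)) ∨
      ((W.HasMultiplicativeReductionAt w ∧ ¬ W.HasSplitMultiplicativeReductionAt w ∧
          W'.HasGoodReductionAt w) ∨
        (W.HasGoodReductionAt w ∧ W'.HasMultiplicativeReductionAt w ∧
          ¬ W'.HasSplitMultiplicativeReductionAt w)) ∨
      ((p : 𝓞 ℚ) ∈ w.asIdeal) ∨
      (1 < w.valuation ℚ W.j ∧ 1 < w.valuation ℚ W'.j ∧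
        (∃ r : w.adicCompletion ℚ, algebraMap ℚ (w.adicCompletion ℚ) (-(W.c₄ / W.c₆)) =
          r ^ 2 * algebraMap ℚ (w.adicCompletion ℚ) (-(W'.c₄ / W'.c₆))) ∧
        (∀ ζ : w.adicCompletion ℚ, ζ ^ p = 1 → ζ = 1))) :
    BSDp W p := by
  have hirr : Irr W p := hasIrreducibleModPGaloisRep_of_hasSurjectiveModNGaloisRep W p hsurj
  have hX : ClassX4M W p := ⟨⟨hc.1, hc.2.1, hirr⟩, ⟨hc.2.1, hc.2.2⟩⟩
  obtain ⟨hp2, -, hj⟩ := hc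
  change padicValRat p W.j < 0 at hj
  have hlow : MissingLowerBoundAt W p := by
    refine missingLowerBoundAt_rankZero_irr_of_potMultWitness₆ hCT hGZK hU hU2 hF44 hp2 hirr hr hq hv W' θ
      hθ S hS P hP fun w hw ↦ ?_
    rcases hplaces w hw with h | h | h | h | h | hwp | h
    · exact Or.inl h
    · exact Or.inr (Or.inl h)
    · exact Or.inr (Or.inr (Or.inl h))
    · exact Or.inr (Or.inr (Or.inr (Or.inl h)))
    · exact Or.inr (Or.inr (Or.inr (Or.inr (Or.inl h))))
    · have hpv : (primesEquiv w : ℕ) = p := primesEquiv_eq_of_natCast_mem w hp.out hwp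
      have hjW0 : W.j ≠ 0 := fun h ↦ by rw [h, padicValRat.zero] at hj; exact lt_irrefl _ hj
      have hjW'0 : W'.j ≠ 0 := fun h ↦ by rw [h, padicValRat.zero] at hj'; exact lt_irrefl _ hj'
      exact Or.inr (Or.inr (Or.inr (Or.inr (Or.inr
        ⟨(TwistedKummer.one_lt_valuation_iff_padicValRat_neg w hpv hjW0).mpr hj,
          (TwistedKummer.one_lt_valuation_iff_padicValRat_neg w hpv hjW'0).mpr hj', hγ w hwp,
          adicCompletion_rat_pow_eq_one_imp_eq_one_above hp2 w hpv⟩))))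
    · exact Or.inr (Or.inr (Or.inr (Or.inr (Or.inr h))))
  exact ClassX4M.bsdp_rankZero_of_surj_of_lower_noL20 hDel hGZK hmod hmodD hKato hX hr hsurj hlow

end Doors

end Summit.BirchSwinnertonDyer.BirchSwinnertonDyer.Theorems.AdditiveBranchIMCMultLowerCompanion

end
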